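import Summits.MatrixMultiplication.OmegaCensus.STPP222IcosetRankFourReduction
import Summits.MatrixMultiplication.OmegaCensus.STPP222IcosetInvolutionForm
import Summits.MatrixMultiplication.OmegaCensus.STPP222IcosetR4NoneK6Z5A
import Summits.MatrixMultiplication.OmegaCensus.STPP222IcosetR4NoneK6Z5B
import Summits.MatrixMultiplication.OmegaCensus.STPP222IcosetR4NoneK6Z5C
import Summits.MatrixMultiplication.OmegaCensus.STPP222IcosetR4NoneK6Z5D
import Summits.MatrixMultiplication.OmegaCensus.STPP222IcosetR4NoneK6Z5E
import Summits.MatrixMultiplication.OmegaCensus.STPP222IcosetR4NoneK6Z5F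
import Summits.MatrixMultiplication.OmegaCensus.STPP222IcosetR4NoneK6Z5G
import Summits.MatrixMultiplication.OmegaCensus.STPP222IcosetR4NoneK6Z5H
import Summits.MatrixMultiplication.OmegaCensus.STPP222IcosetR4NoneK6Z5I
import Summits.MatrixMultiplication.OmegaCensus.STPP222IcosetR4NoneK6Z5J
import Summits.MatrixMultiplication.OmegaCensus.STPP222IcosetR4NoneK6Z5K
import Summits.MatrixMultiplication.OmegaCensus.STPP222IcosetR4NoneK6Z5L
import Summits.MatrixMultiplication.OmegaCensus.STPP222IcosetR4NoneK6Z5M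

/-!
# ω-census, icoset class negatives at 2-rank FOUR, KERNEL: no involution-coset `(2,2,2)⁶` family in `𝔽₂⁴ × ℤ₅` (order 80)

HONEST FRAMING (pub-omega census; verbatim): lottery ticket; floor = certified bounds/negative ranges.
Census STRUCTURE bookkeeping (question Q7; a CLASS-INTERNAL negative — it says nothing about unrestricted `(2,2,2)⁶` families in
`ℤ₂⁴ × ℤ₅` and nothing about `ω`).  OMEGA-TABLE NR216 (ENG2 gen 28, engines `icwc` / `icrc`, 6 055 canonical H-classes, class NONE ×2
engines ×3 builds) re-derived IN THE KERNEL: the thirteen part files `STPP222IcosetR4NoneK6Z5A … M` evaluate the witness-model search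
`IcosetW.chunk / chunk3` (`STPP222IcosetWSearch.lean`) over every sorted code tuple of the `H`-data (38 025 tuples with `c₁ ≤ 1`:
6 055 canonical classes, 62 432 search nodes, all refuted; 80 730 tuples with `c₁ ≥ 2`: none canonical); `classOk_z5_six` assembles
them into "the engine accepts every sorted code class", and the reduction `IcosetW.not_exists_r4_of_classOk`
(`STPP222IcosetRankFourReduction.lean`, resting on the soundness chain `STPP222IcosetWSearchPrims/Triples/Linear/Select/Sound.lean`,
the bit bridge `STPP222IcosetRankFourBits.lean` and the canonical-form files `STPP222IcosetRankFourCodes/Canon.lean`) turns that into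
**`no_icoset_pow6_F2pow4_zmod5`** and, in the census wording (every set a coset of an order-2 subgroup), **`no_involutionCoset_pow6_F2pow4_zmod5`**.
With the 2-rank-3 cells of seat gen 19 (`𝔽₂³ × ℤ₇ / ℤ₉ / ℤ₃² / ℤ₁₁`) this is the first 2-rank-4 cell of the icoset class census in the kernel.
References: H. Cohn, R. Kleinberg, B. Szegedy, C. Umans, FOCS 2005 (arXiv:math/0511460), Def. 5.1; cell note
`HOME/pub-omega-eng2-g28/icoset/ICR-NOTE.md` (ENG2 gen 28).  Seat pub-omega-kernel-l4 (gen 20), 2026-08-27.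
-/

namespace Summit.MatrixMultiplication.OmegaCensus

open Literature.Computability.AlgebraicComplexity

namespace IcosetW

/-- The classes with `c₁ ≥ 2` (parts L, M). -/
theorem chunk_z5_six_ge_two : ∀ c1, 2 ≤ c1 → c1 < 25 → chunk 5 6 [1, 2, 3, 4] c1 c1 25 = true := by
  intro c1 h2 h25
  interval_cases c1
  exacts [chunk_z5_six_2_2_25, chunk_z5_six_3_3_25, chunk_z5_six_4_4_25, chunk_z5_six_5_5_25, chunk_z5_six_6_6_25,
    chunk_z5_six_7_7_25, chunk_z5_six_8_8_25, chunk_z5_six_9_9_25, chunk_z5_six_10_10_25, chunk_z5_six_11_11_25,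
    chunk_z5_six_12_12_25, chunk_z5_six_13_13_25, chunk_z5_six_14_14_25, chunk_z5_six_15_15_25, chunk_z5_six_16_16_25,
    chunk_z5_six_17_17_25, chunk_z5_six_18_18_25, chunk_z5_six_19_19_25, chunk_z5_six_20_20_25, chunk_z5_six_21_21_25,
    chunk_z5_six_22_22_25, chunk_z5_six_23_23_25, chunk_z5_six_24_24_25]

/-- **The engine accepts every sorted code class of `𝔽₂⁴ × ℤ₅`, `K = 6`** (assembled from the thirteen part files). -/
theorem classOk_z5_six (c1 c2 c3 c4 c5 : ℕ) (h12 : c1 ≤ c2) (h23 : c2 ≤ c3) (h34 : c3 ≤ c4) (h45 : c4 ≤ c5) (h5 : c5 < 25) :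
    classOk 5 6 [1, 2, 3, 4] [0, c1, c2, c3, c4, c5] = true := by
  have hch2 : List.IsChain (· ≤ ·) [c2, c3, c4, c5] := by simp [h23, h34, h45]
  have hch3 : List.IsChain (· ≤ ·) [c3, c4, c5] := by simp [h34, h45]
  have hlt3 : ∀ c ∈ [c3, c4, c5], c < 5 * 5 := by intro c hc; simp at hc; omega
  have hlt4 : ∀ c ∈ [c4, c5], c < 5 * 5 := by intro c hc; simp at hc; omega
  have viaChunk : ∀ ⦃lo hi : ℕ⦄, chunk 5 6 [1, 2, 3, 4] c1 lo hi = true → lo ≤ c2 → c2 < hi →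
      classOk 5 6 [1, 2, 3, 4] [0, c1, c2, c3, c4, c5] = true := fun lo hi h hlo hhi =>
    allTuples_sound 3 c2 [0, c1, c2] [c3, c4, c5] (chunk_sound h hlo hhi h12) rfl hch2 hlt3
  have viaChunk3 : ∀ ⦃lo hi : ℕ⦄, chunk3 5 6 [1, 2, 3, 4] c1 c2 lo hi = true → lo ≤ c3 → c3 < hi →
      classOk 5 6 [1, 2, 3, 4] [0, c1, c2, c3, c4, c5] = true := fun lo hi h hlo hhi =>
    allTuples_sound 2 c3 [0, c1, c2, c3] [c4, c5] (chunk3_sound h hlo hhi h23) rfl hch3 hlt4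
  rcases Nat.lt_or_ge c1 2 with hc1 | hc1
  · interval_cases c1
    · -- c₁ = 0
      rcases Nat.lt_or_ge c2 1 with hA | hA
      · exact viaChunk chunk_z5_six_0_0_1 (Nat.zero_le _) hA
      rcases Nat.lt_or_ge c2 2 with hB | hB
      · obtain rfl : c2 = 1 := by omega
        rcases Nat.lt_or_ge c3 8 with hc3 | hc3
        · exact viaChunk3 chunk3_z5_six_0_1_1_8 h23 hc3
        · exact viaChunk3 chunk3_z5_six_0_1_8_25 hc3 (by omega)
      rcases Nat.lt_or_ge c2 5 with hC | hC
      · exact viaChunk chunk_z5_six_0_2_5 hB hC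
      rcases Nat.lt_or_ge c2 6 with hD | hD
      · exact viaChunk chunk_z5_six_0_5_6 hC hD
      · exact viaChunk chunk_z5_six_0_6_25 hD (by omega)
    · -- c₁ = 1
      rcases Nat.lt_or_ge c2 5 with hA | hA
      · exact viaChunk chunk_z5_six_1_1_5 h12 hA
      rcases Nat.lt_or_ge c2 6 with hB | hB
      · obtain rfl : c2 = 5 := by omega
        rcases Nat.lt_or_ge c3 9 with hc3 | hc3
        · exact viaChunk3 chunk3_z5_six_1_5_5_9 h23 hc3
        rcases Nat.lt_or_ge c3 13 with hc3b | hc3b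
        · exact viaChunk3 chunk3_z5_six_1_5_9_13 hc3 hc3b
        · exact viaChunk3 chunk3_z5_six_1_5_13_25 hc3b (by omega)
      rcases Nat.lt_or_ge c2 7 with hC | hC
      · exact viaChunk chunk_z5_six_1_6_7 hB hC
      rcases Nat.lt_or_ge c2 8 with hD | hD
      · exact viaChunk chunk_z5_six_1_7_8 hC hD
      rcases Nat.lt_or_ge c2 9 with hE | hE
      · obtain rfl : c2 = 8 := by omega
        rcases Nat.lt_or_ge c3 14 with hc3 | hc3
        · exact viaChunk3 chunk3_z5_six_1_8_8_14 h23 hc3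
        · exact viaChunk3 chunk3_z5_six_1_8_14_25 hc3 (by omega)
      · exact viaChunk chunk_z5_six_1_9_25 hE (by omega)
  · exact viaChunk (chunk_z5_six_ge_two c1 hc1 (by omega)) h12 (by omega)

/-- The engine accepts every sorted code class, list form. -/
theorem classOk_z5_six_list (C : List ℕ) (hl : C.length = 5) (hs : C.Pairwise (· ≤ ·)) (hlt : ∀ c ∈ C, c < 5 * 5) :
    classOk 5 6 [1, 2, 3, 4] (0 :: C) = true := by
  match C, hl with
  | [c1, c2, c3, c4, c5], _ =>
    have h12 : c1 ≤ c2 := List.rel_of_pairwise_cons hs (by simp)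
    have hs2 := hs.of_cons
    have h23 : c2 ≤ c3 := List.rel_of_pairwise_cons hs2 (by simp)
    have hs3 := hs2.of_cons
    have h34 : c3 ≤ c4 := List.rel_of_pairwise_cons hs3 (by simp)
    have hs4 := hs3.of_cons
    have h45 : c4 ≤ c5 := List.rel_of_pairwise_cons hs4 (by simp)
    exact classOk_z5_six c1 c2 c3 c4 c5 h12 h23 h34 h45 (by have := hlt c5 (by simp); omega)

/-- The units `1, 2, 3, 4` of `ℤ₅`: invertible, closed under products. -/
theorem units_z5 : (∀ u ∈ [1, 2, 3, 4], IsUnit ((u : ℕ) : ZMod 5)) ∧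
    (∀ u ∈ [1, 2, 3, 4], ∀ u' ∈ [1, 2, 3, 4], u * u' % 5 ∈ [1, 2, 3, 4]) := by
  refine ⟨fun u hu => ?_, by decide⟩
  simp only [List.mem_cons, List.not_mem_nil, or_false] at hu
  rcases hu with rfl | rfl | rfl | rfl
  · exact isUnit_iff_exists_inv.mpr ⟨((1 : ℕ) : ZMod 5), by decide⟩
  · exact isUnit_iff_exists_inv.mpr ⟨((3 : ℕ) : ZMod 5), by decide⟩
  · exact isUnit_iff_exists_inv.mpr ⟨((2 : ℕ) : ZMod 5), by decide⟩
  · exact isUnit_iff_exists_inv.mpr ⟨((4 : ℕ) : ZMod 5), by decide⟩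

end IcosetW

/-- **`𝔽₂⁴ × ℤ₅` (order 80, 2-rank four) has no involution-coset `(2,2,2)⁶` STPP family** — KERNEL (class-internal negative;
OMEGA-TABLE NR216; inside the class the onset is `n₆ = 96`). [cite: CohnKleinbergSzegedyUmans2005, Def. 5.1] -/
theorem no_icoset_pow6_F2pow4_zmod5 :
    ¬ ∃ A B C : Fin 6 → Finset ((ZMod 2 × ZMod 2 × ZMod 2 × ZMod 2) × ZMod 5), Icoset.IsIcosetFamily A B C ∧ IsSTPP A B C :=
  IcosetW.not_exists_r4_of_classOk (n := 5) (K := 5) (by norm_num) [1, 2, 3, 4] IcosetW.units_z5.1 IcosetW.units_z5.2 1 (by simp)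
    IcosetW.classOk_z5_six_list

/-- `ℤ₅` has no 2-torsion. [folklore] -/
theorem no_two_torsion_zmod5 : ∀ h : ZMod 5, h + h = 0 → h = 0 := by decide

/-- **`𝔽₂⁴ × ℤ₅`: no `(2,2,2)⁶` STPP family all of whose sets are cosets of order-2 subgroups** — KERNEL, class-internal, the census
wording (ENG2 `icwc` / `icrc` class of `ICR-NOTE.md`). [cite: CohnKleinbergSzegedyUmans2005, Def. 5.1] -/
theorem no_involutionCoset_pow6_F2pow4_zmod5 :
    ¬ ∃ A B C : Fin 6 → Finset ((ZMod 2 × ZMod 2 × ZMod 2 × ZMod 2) × ZMod 5),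
      Icoset.IsInvolutionCosetFamily A B C ∧ IsSTPP A B C :=
  fun ⟨A, B, C, hF, hS⟩ =>
    no_icoset_pow6_F2pow4_zmod5 ⟨A, B, C, Icoset.isIcosetFamily_of_involution_cosets no_two_torsion_zmod5 hF, hS⟩

end Summit.MatrixMultiplication.OmegaCensus
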